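import Mathlib

/-!
# (XA′) on the FOUR-ATOM model by an explicit 49-term certificate (blind cell PercRepro2, night-2 g27; §68.7)

Variables: the masses of `ν`, `νu`, `νw` on the four atoms `∅` (o, ou), `V` (A, Au, Aw), `W` (b, bu, bw), `VW` (ru, rw) of the
lattice `2^{j, m}` (`ent' = {j}`, `ent = {m}`, `V = {j}`, `W = {m}`), markers `x = 1[j ∈ ·]`,
`y = 1[m ∈ ·]`.  The chain laws: `R⁰ = (o, A, bu, ru)`, `R¹ = (o, Au, bu, ru)`, `G⁰ = (o, A, bw, rw)`,
`G¹ = (o, Aw, bw, rw)`.  From the order constraints and SIX Ahlswede–Daykin products —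
`o·ru ≥ A·bu`, `o·rw ≥ A·bw`, `ou·ru ≥ Au·bu`, `ou·rw ≥ Au·bw`, `o·rw ≥ b·Aw`, `ou·rw ≥ bu·Aw`
(two of them through the HIDDEN masses `b = ν(W)`, `ou = νu(∅)`) — the cleared (XA′) inequality
`Cross ≤ a0·U001` follows as a positive integer combination of 49 products (found by LP, kit
j304677; coefficients 1 and 2), checked here by `linear_combination` of the 49 nonnegative products.
-/

namespace Summit.Ventures.PercRepro2.Coin

section FourAtom

variable {R : Type*} [Field R] [LinearOrder R] [IsStrictOrderedRing R]

/-- **(XA′) ON THE FOUR-ATOM MODEL** from six Ahlswede–Daykin products and the order constraints. -/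
theorem xa_four_atom (o A b ou Au bu ru Aw bw rw : R)
    (ho : 0 ≤ o) (hA : 0 ≤ A) (hAu : 0 ≤ Au) (hbu : 0 ≤ bu)
    (hru : 0 ≤ ru) (hAw : 0 ≤ Aw) (hbw : 0 ≤ bw) (hrw : 0 ≤ rw)
    (hou_o : 0 ≤ -ou + o) (hAu_A : 0 ≤ -Au + A) (hAw_Au : 0 ≤ -Aw + Au)
    (hbu_b : 0 ≤ -bu + b) (hbw_bu : 0 ≤ -bw + bu) (hrw_ru : 0 ≤ -rw + ru)
    (had1 : 0 ≤ -A * bu + o * ru) (had2 : 0 ≤ -A * bw + o * rw) (had3 : 0 ≤ -Au * bu + ou * ru)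
    (had4 : 0 ≤ -Au * bw + ou * rw) (had5 : 0 ≤ -b * Aw + o * rw) (had6 : 0 ≤ -bu * Aw + ou * rw) :
    ((o + A + bu + ru) * (Au + ru) - (A + ru) * (o + Au + bu + ru)) *
        ((o + A + bu + ru) * (bw + rw) - (bu + ru) * (o + A + bw + rw))
      + ((o + A + bu + ru) * (bu + ru) - (bu + ru) * (o + Au + bu + ru)) *
        ((o + A + bu + ru) * (A + rw) - (A + ru) * (o + A + bw + rw))
    ≤ (o + A + bu + ru) * ((o + A + bu + ru) * (o + A + bu + ru) * rw
        - (o + A + bu + ru) * (bu + ru) * (Aw + rw)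
        - (o + A + bu + ru) * (A + ru) * (bw + rw)
        + (A + ru) * (bu + ru) * (o + Aw + bw + rw)) := by
  have hoA : 0 ≤ o * A := mul_nonneg ho hA
  have hoAu : 0 ≤ o * Au := mul_nonneg ho hAu
  have hoAw : 0 ≤ o * Aw := mul_nonneg ho hAw
  have horu : 0 ≤ o * ru := mul_nonneg ho hru
  have horw : 0 ≤ o * rw := mul_nonneg ho hrw
  have hobu : 0 ≤ o * bu := mul_nonneg ho hbu
  have H0 := (mul_nonneg hoA had2)
  have H1 := (mul_nonneg had2 horu)
  have H2 := (mul_nonneg had5 hobu)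
  have H3 := (mul_nonneg had6 horu)
  have H4 := (mul_nonneg had2 (mul_nonneg hAu hru))
  have H5 := (mul_nonneg had2 (mul_nonneg hA hru))
  have H6 := (mul_nonneg had2 (mul_nonneg hA hA))
  have H7 := (mul_nonneg had4 (mul_nonneg hbu hru))
  have H8 := (mul_nonneg had4 (mul_nonneg hA hbu))
  have H9 := (mul_nonneg had5 (mul_nonneg hbu hru))
  have H10 := (mul_nonneg had5 (mul_nonneg hA hbu))
  have H11 := (mul_nonneg had6 (mul_nonneg hru hru))
  have H12 := (mul_nonneg had6 (mul_nonneg hbu hbu))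
  have H13 := (mul_nonneg had6 (mul_nonneg ho ho))
  have H14 := (mul_nonneg (mul_nonneg hoA hAw_Au) hru)
  have H15 := (mul_nonneg (mul_nonneg hoA hAw_Au) hbu)
  have H16 := (mul_nonneg (mul_nonneg hoA hAu_A) hrw)
  have H17 := (mul_nonneg (mul_nonneg hoA hAu_A) hbw)
  have H18 := (mul_nonneg (mul_nonneg hoA hbw_bu) hru)
  have H19 := (mul_nonneg (mul_nonneg hoAu hbw_bu) hbu)
  have H20 := (mul_nonneg (mul_nonneg hoAu hbw_bu) ho)
  have H21 := (mul_nonneg (mul_nonneg hoAw hbu_b) hbu)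
  have H22 := (mul_nonneg (mul_nonneg had1 hAu_A) hru)
  have H23 := (mul_nonneg (mul_nonneg had1 hAu_A) hbu)
  have H24 := (mul_nonneg (mul_nonneg had1 hrw_ru) hA)
  have H25 := (mul_nonneg (mul_nonneg had1 hrw_ru) ho)
  have H26 := (mul_nonneg (mul_nonneg had3 hrw_ru) hru)
  have H27 := (mul_nonneg (mul_nonneg had3 hrw_ru) hbu)
  have H28 := (mul_nonneg (mul_nonneg horu hou_o) hrw)
  have H29 := (mul_nonneg (mul_nonneg horu hAw_Au) hru)
  have H30 := (mul_nonneg (mul_nonneg horu hAw_Au) hbu)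
  have H31 := (mul_nonneg (mul_nonneg horu hAw_Au) ho)
  have H32 := (mul_nonneg (mul_nonneg horu hAu_A) hru)
  have H33 := (mul_nonneg (mul_nonneg horu hbw_bu) hru)
  have H34 := (mul_nonneg (mul_nonneg horu hbw_bu) hbu)
  have H35 := (mul_nonneg (mul_nonneg horu hbw_bu) ho)
  have H36 := (mul_nonneg (mul_nonneg horw hou_o) ho)
  have H37 := (mul_nonneg (mul_nonneg horw hAu_A) ho)
  have H38 := (mul_nonneg (mul_nonneg hA hou_o) (mul_nonneg hbu hrw))
  have H39 := (mul_nonneg (mul_nonneg hA hAw_Au) (mul_nonneg hbu hru))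
  have H40 := (mul_nonneg (mul_nonneg hA hAu_A) (mul_nonneg hbu hrw))
  have H41 := (mul_nonneg (mul_nonneg hA hAu_A) (mul_nonneg hbu hbw))
  have H42 := (mul_nonneg (mul_nonneg hA hbu_b) (mul_nonneg hbu hAw))
  have H43 := (mul_nonneg (mul_nonneg hAu hbw_bu) (mul_nonneg hru hru))
  have H44 := (mul_nonneg (mul_nonneg hbu hou_o) (mul_nonneg hru hru))
  have H45 := (mul_nonneg (mul_nonneg hbu hou_o) (mul_nonneg hbu hrw))
  have H46 := (mul_nonneg (mul_nonneg hbu hAw_Au) (mul_nonneg hbu hru))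
  have H47 := (mul_nonneg (mul_nonneg hbu hbu_b) (mul_nonneg hru hAw))
  have H48 := (mul_nonneg (mul_nonneg hru hou_o) (mul_nonneg hru hru))
  linear_combination 2 * H0 + H1 + 2 * H2 + H3 + H4 + H5 + H6 + H7 + H8 + H9 + H10 + H11 + H12 + H13 + H14 + H15 + H16 + H17 + 2 * H18 + H19 + H20 + 2 * H21 + H22 + 2 * H23 + H24 + H25 + H26 + H27 + H28 + H29 + 2 * H30 + H31 + H32 + H33 + H34 + H35 + H36 + H37 + H38 + H39 + H40 + H41 + H42 + H43 + H44 + H45 + H46 + H47 + H48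

end FourAtom

end Summit.Ventures.PercRepro2.Coin
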